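import Literature.Analysis.FluidPDE.MillerMiddleEigenvalueCriterion
import Literature.Analysis.FluidPDE.MillerMiddleEigenvalueGronwall
import Literature.Analysis.FluidPDE.NSSerrinRegularityProofs
import Literature.Analysis.FluidPDE.CheskidovShvydkoyRegularProofs
import Literature.Analysis.FluidPDE.LerayH1ContinuationProofs
import HarnessLib

/-!
# Discharge of Miller's middle-eigenvalue criterion on `ℝ³` (`λ₂⁺ ∈ L^p(0,T; L^q)`, `2/p + 3/q = 2`)

search for candidate a priori estimates; no regularity claim (cell `pub-nsfunc`, literature seat:
this file PROVES a published criterion the tree vendored as a named fact; nothing new).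

Analysis/FluidPDE proof file (theorems only: no definition, no named fact, no `sorry`), sibling of
`MillerMiddleEigenvalueCriterion.lean`, which vendors E. Miller, *A regularity criterion for the
Navier–Stokes equation involving only the middle eigenvalue of the strain tensor*, Arch. Ration.
Mech. Anal. 235 (2020) 99–139 = arXiv:1710.05569, Theorem 1.1 (= Thm. 5.2), in continuation form,
as the named fact `Miller2019.middleEigenvalueCriterion`. **Discharged here**:

  `Miller2019.middleEigenvalueCriterion_holds : Miller2019.middleEigenvalueCriterion`

(a classical solution of the unforced system on `ℝ³ × [0, T)`, Leray–Hopf from its datum, with a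
nonnegative two-frame majorant `m` of the middle principal strain on `[0, T) × ℝ³` such that
`∫₀ᵀ (∫ m(t,x)^q dx)^{2/(2q-3)} dt < ∞`, `3/2 < q < ∞`, extends as a classical solution past `T`;
priority for `λ₂⁺` criteria: Neustupa–Penel 2001, per Miller's Addendum).

## The argument (Miller's proof of Thm. 5.2, arXiv pp. 16–17, assembled on the tree's Leray–Hopf
## structure theory exactly as `BeiraoDaVeiga1995_gradientCriterion_holds`)

1. *The enstrophy inequality* is `miller_enstrophy_bound` (`MillerMiddleEigenvalueGronwall.lean`):
   on a classical slab of Tao's `L²`-Sobolev class,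
   `∫|∇u(s)|²_F ≤ exp(C ν^{1-p} ∫₀ˢ (∫ m^q)^{2/(2q-3)}) ∫|∇u(0)|²_F` for any nonnegative two-frame
   majorant `m` of `λ₂(∇u)` on `(0, s)` (Miller's Lemma 5.1, `∫ det ∇u = 0`, Hölder,
   interpolation, Sobolev, Young, Grönwall).
2. *No blow-up of the enstrophy before `T`* (`exists_eWeakGradL2Sq_le_of_midStrain`,
   `limsup_eH1NormSq_lt_top_of_midStrain`): on an `H¹`-regular interval `(α, β) ⊆ (0, T)` of the
   Leray–Hopf solution the bound is continued along `[t₀, t]` by real induction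
   (`forall_Icc_of_local_propagation`); locally it is step 1 applied to a classical patch of Tao's
   class issued from a good time (`exists_tao_patch`, `taoSlab_translate`) — whose slices coincide
   EVERYWHERE with the (continuous) slices of the classical `u`, so that the velocity GRADIENTS
   agree and the two-frame majorant `m`, shifted in time, is a majorant for the patch; the time
   weight is translated by `setLIntegral_Ioo_comp_add_right`; the exponentials chain
   (`exp_lintegral_chain`). With `IsLerayHopfOn.eEnergy_le_datum`, `limsup_{β⁻} ‖u‖²_{H¹} < ∞`.
3. *Continuation.* Leray's continuation theorem (`leray_continuation_H1_holds`) gives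
   `H¹`-regularity on `(0, T]`; then, verbatim as in `GradientRegularityCriteriaProofs.lean`
   (Robinson–Rodrigo–Sadowski 2016, proof of Thm. 12.3, p. 170): restart at a good time near `T`
   with Leray's local strong solution (`leray_local_strong_H1_holds`), represent it classically
   (`ladyzhenskaya_prodi_serrin_holds`), identify it with `u` by weak–strong uniqueness
   (`serrin_weak_strong_uniqueness_holds`) and continuity, and glue (`IsClassicalNSSolutionOn.glue`).

No measurability of `m` is ever used (the fact quantifies over arbitrary `m ≥ 0`): only lower
integrals of `m` and the continuous weight `λ₂⁺ ∘ ∇u ≤ m` enter. The rapid-decay hypothesis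
`HasRapidSpatialDecay (u 0)` of the named fact is not used (it is proved as stated). Net effect on
the facts census: `−1` (`Miller2019.middleEigenvalueCriterion` discharged; nothing new vendored).

## Mathlib / tree search

`lean search 'middleEigenvalueCriterion_holds'`: absent before this file. All inputs are accepted
tree theorems, cited in place; Mathlib has no Navier–Stokes theory.

## References

* E. Miller, Arch. Ration. Mech. Anal. 235 (2020) 99–139, doi:10.1007/s00205-019-01419-z,
  arXiv:1710.05569 — Thm. 1.1 = Thm. 5.2 (arXiv pp. 16–17), Lemma 5.1. [Miller2019]
* J. Neustupa, P. Penel, in *Mathematical Fluid Mechanics*, Birkhäuser 2001, 237–265,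
  doi:10.1007/978-3-0348-8243-9_10, Thm. 2. [NeustupaPenel2001]
* J. C. Robinson, J. L. Rodrigo, W. Sadowski, *The Three-Dimensional Navier–Stokes Equations*,
  CUP (2016), Lemma 8.16, Thm. 8.17, Thm. 6.15, Thm. 6.10, proof of Thm. 12.3 (p. 170).
  [RobinsonRodrigoSadowski2016]
* A. Cheskidov, R. Shvydkoy, Arch. Ration. Mech. Anal. 195 (2010), Thm. 2.4. [CheskidovShvydkoy2010]
* T. Tao, Anal. PDE 6 (2013), Thm. 5.4, Prop. 5.6. [Tao2011]
-/

noncomputable section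

open MeasureTheory Set Function Filter Topology InnerProductSpace
open scoped ENNReal NNReal ContDiff RealInnerProductSpace

namespace Literature.Analysis.FluidPDE

-- Physical space is written out as `EuclideanSpace ℝ (Fin 3)` (no local notation).

/-! ### Step A: the Miller bound at the right end of an interval of regularity -/

section StepA

variable {ν T : ℝ} {u₀ : EuclideanSpace ℝ (Fin 3) → EuclideanSpace ℝ (Fin 3)}
  {u : ℝ → EuclideanSpace ℝ (Fin 3) → EuclideanSpace ℝ (Fin 3)}
  {p : ℝ → EuclideanSpace ℝ (Fin 3) → ℝ}

/-- **Uniform enstrophy bound towards the right end of an interval of regularity, in Miller's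
class** (the twin of `exists_eWeakGradL2Sq_le_of_gradient`; Miller 2019, Thm. 1.1: no blow-up of
`‖∇u‖₂` while `∫ ‖λ₂⁺‖^p_{L^q} < ∞`). Let `(u, p)` be a classical solution of the unforced system
on `ℝ³ × [0, T)` which is Leray–Hopf on `[0, T)`, `3/2 < r`, and `m ≥ 0` a two-frame majorant of the
middle principal strain of `∇u(t, x)` at every `t ∈ [0, T)`, `x ∈ ℝ³`, with
`Ā = ∫₀ᵀ (∫ m(t)^r)^{2/(2r-3)} dt < ∞`; let `u` be `H¹`-regular on an open interval
`(α, β) ⊆ (0, T)` and `t₀ ∈ (α, β)`. Given Tao's local `H¹` theory (`TaoH1AlmostRegularWith c`,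
`c > 0`), for every `t ∈ [t₀, β)`: `‖∇u(t)‖² ≤ exp(C ν^{1-p} Ā) ‖∇u(t₀)‖² < ∞`, `C` the constant of
`miller_enstrophy_bound`. Proof: continuation along `[t₀, t]` by `forall_Icc_of_local_propagation`;
near any `σ` a classical patch from a good time just below `σ` (`exists_tao_patch`) carries
`τ₁ ≤ τ₂`; on it the slices of the patch EQUAL those of `u` (both continuous, a.e. equal), so the
gradients agree and the time-shifted `m` is a two-frame majorant for the patch; Miller's enstrophy
inequality on the translated slab (`miller_enstrophy_bound`) bounds `‖∇u(τ₂)‖²` by `‖∇u(τ₁)‖²`;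
the exponentials chain (`exp_lintegral_chain`). [cite: Miller2019, Thm 1.1 (proof of Thm 5.2)]
[cite: RobinsonRodrigoSadowski2016, Lemma 8.16 (proof)] -/
theorem exists_eWeakGradL2Sq_le_of_midStrain {c : ℝ} (hL2 : TaoH1AlmostRegularWith c) (hc : 0 < c)
    (hν : 0 < ν) (hLH : IsLerayHopfOn T ν 0 u₀ u) (hcl : IsClassicalNSSolutionOn (Ico 0 T) ν 0 u p)
    {r : ℝ} (hr : 3 / 2 < r)
    {m : ℝ → EuclideanSpace ℝ (Fin 3) → ℝ} (hm0 : ∀ t x, 0 ≤ m t x)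
    (hmaj : ∀ t ∈ Ico 0 T, ∀ x, ∃ v w : EuclideanSpace ℝ (Fin 3), ‖v‖ = 1 ∧ ‖w‖ = 1 ∧
      ⟪v, w⟫ = 0 ∧ ∀ α β : ℝ,
        ⟪fderiv ℝ (u t) x (α • v + β • w), α • v + β • w⟫ ≤ m t x * (α ^ 2 + β ^ 2))
    (hA : ∫⁻ t in Ioo 0 T, (∫⁻ x, ENNReal.ofReal (m t x) ^ r) ^ (2 / (2 * r - 3)) ≠ ⊤)
    {α β : ℝ} (hα : 0 ≤ α) (hβ : β ≤ T) (hreg : IsH1RegularOn (Ioo α β) u)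
    {t₀ : ℝ} (ht₀ : t₀ ∈ Ioo α β) :
    ∃ K : ℝ≥0∞, K < ⊤ ∧ ∀ t ∈ Ico t₀ β, eWeakGradL2Sq (u t) ≤ K := by
  -- notation
  set q' : ℝ := 1 - 1 / (1 - 3 / (2 * r)) with hq'
  set a : ℝ → ℝ≥0∞ := fun σ => (∫⁻ x, ENNReal.ofReal (m σ x) ^ r) ^ (2 / (2 * r - 3)) with ha
  obtain ⟨C, hC0, hD2⟩ := miller_enstrophy_bound hr
  set Cν : ℝ := C * ν ^ q' with hCν
  have hCν0 : 0 ≤ Cν := mul_nonneg hC0 (Real.rpow_nonneg hν.le _)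
  set y₀ : ℝ≥0∞ := eWeakGradL2Sq (u t₀) with hy₀def
  have hy₀ : y₀ < ⊤ := lt_of_le_of_lt le_add_self (hreg.eH1NormSq_lt_top ht₀)
  refine ⟨ENNReal.ofReal (Real.exp (Cν * (∫⁻ σ in Ioo 0 T, a σ).toReal)) * y₀,
    ENNReal.mul_lt_top ENNReal.ofReal_lt_top hy₀, fun t ht => ?_⟩
  have ht₀0 : 0 < t₀ := hα.trans_lt ht₀.1
  have htT : t < T := ht.2.trans_le hβ
  -- good restarting times
  have hgood : ∀ᵐ s ∂(volume.restrict (Ioo 0 T)),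
      IsLerayHopfOn (T - s) ν 0 (u s) (fun t => u (t + s)) := hLH.ae_isLerayHopfOn_restart hν.le
  -- a uniform `H¹` bound on the compact `[(α + t₀)/2, t]`
  have hKsub : Icc ((α + t₀) / 2) t ⊆ Ioo α β := fun s hs =>
    ⟨lt_of_lt_of_le (by linarith [ht₀.1]) hs.1, hs.2.trans_lt ht.2⟩
  obtain ⟨M, hM, hbound⟩ := hreg.exists_forall_le isCompact_Icc hKsub
  set Am : ℝ := M.toReal with hAm
  have hAm0 : 0 ≤ Am := ENNReal.toReal_nonneg
  set τM : ℝ := c * ν ^ 3 / (Am ^ 2 + 1) with hτM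
  have hτM0 : 0 < τM := by positivity
  have hτMc : Am ^ 2 * τM ≤ c * ν ^ 3 := by
    rw [hτM, mul_div_assoc']
    rw [div_le_iff₀ (by positivity)]
    nlinarith [mul_pos hc (pow_pos hν 3)]
  -- the propagated property
  set A : ℝ → ℝ := fun τ => (∫⁻ σ in Ioo t₀ τ, a σ).toReal with hAdef
  set P : ℝ → Prop := fun τ => eWeakGradL2Sq (u τ) ≤ ENNReal.ofReal (Real.exp (Cν * A τ)) * y₀
    with hPdef
  have hPt : P t := by
    refine forall_Icc_of_local_propagation (a := t₀) (b := t) (P := P) ?_ ?_ t ⟨ht.1, le_rfl⟩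
    · -- `P t₀`
      simp only [hPdef, hAdef, Ioo_self, Measure.restrict_empty, lintegral_zero_measure,
        ENNReal.toReal_zero, mul_zero, Real.exp_zero, ENNReal.ofReal_one, one_mul, hy₀def, le_refl]
    · -- local propagation around `σ ∈ [t₀, t]`
      intro σ hσ
      have hσT : σ ≤ T := (hσ.2.trans ht.2.le).trans hβ
      -- a good time `s` just below `σ`
      have hlo : 0 ≤ max ((α + t₀) / 2) (σ - τM / 2) := le_max_of_le_left (by linarith)
      have hlt : max ((α + t₀) / 2) (σ - τM / 2) < σ :=
        max_lt (by linarith [hσ.1, ht₀.1]) (by linarith)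
      obtain ⟨s, hs, hLHs⟩ := exists_mem_Ioo_of_ae_restrict_Ioo hlo hlt hσT hgood
      have hs1 : (α + t₀) / 2 < s := (le_max_left _ _).trans_lt hs.1
      have hs2 : σ - τM / 2 < s := (le_max_right _ _).trans_lt hs.1
      have hs0 : 0 < s := lt_of_le_of_lt (by linarith) hs1
      have hsT : s < T := hs.2.trans_le hσT
      have hsK : s ∈ Icc ((α + t₀) / 2) t := ⟨hs1.le, hs.2.le.trans hσ.2⟩
      have hAs : eH1NormSq (u s) ≤ ENNReal.ofReal Am := by
        rw [hAm, ENNReal.ofReal_toReal hM.ne]; exact hbound s hsK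
      set τ' : ℝ := min τM (T - s) with hτ'def
      refine ⟨min (σ - s) (τM / 2), lt_min (sub_pos.2 hs.2) (by positivity), ?_⟩
      intro τ₁ hτ₁ τ₂ hτ₂ hτ₁σ hτ₁₂ hτ₂σ hP1
      rcases eq_or_lt_of_le hτ₁₂ with heq | hlt12
      · rw [← heq]; exact hP1
      -- the patch from `s` covers `[τ₁, τ₂]`
      have hδ1 : min (σ - s) (τM / 2) ≤ σ - s := min_le_left _ _
      have hδ2 : min (σ - s) (τM / 2) ≤ τM / 2 := min_le_right _ _
      have hsτ₁ : s < τ₁ := by linarith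
      have hτ₂T : τ₂ < T := lt_of_le_of_lt hτ₂.2 htT
      have hτ₂τ' : τ₂ - s < τ' := by
        refine lt_min (by linarith) ?_
        linarith [hτ₂.2, ht.2, hβ]
      set ε : ℝ := τ₁ - s with hεdef
      have hε0 : 0 < ε := sub_pos.2 hsτ₁
      have hετ' : ε < τ' := lt_trans (by rw [hεdef]; linarith) hτ₂τ'
      obtain ⟨w, π, hw, hbw, hbwt, hbπ, hrep⟩ := exists_tao_patch hL2 hν hLH ⟨hs0, hsT⟩ hLHs hAm0
        hAs hτM0 hτMc (ε := ε) ⟨hε0, hετ'⟩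
      -- translate to the slab `[0, τ' - ε]`, i.e. `u`-times `[τ₁, s + τ']`
      obtain ⟨hw', hbw', hbwt', hbπ'⟩ := taoSlab_translate hw hbw hbwt hbπ (e := ε) ⟨le_rfl, hετ'⟩
      have hL : 0 < τ' - ε := sub_pos.2 hετ'
      have hrep' : ∀ t' ∈ Icc 0 (τ' - ε), u (t' + τ₁) =ᵐ[volume] w (t' + ε) := by
        intro t' ht'
        have h := hrep (t' + ε) ⟨by linarith [ht'.1], by linarith [ht'.2]⟩
        have e1 : t' + ε + s = t' + τ₁ := by rw [hεdef]; ring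
        rwa [e1] at h
      have hs12 : τ₂ - τ₁ ∈ Ioc 0 (τ' - ε) := ⟨sub_pos.2 hlt12, by rw [hεdef]; linarith⟩
      -- on `u`-times `< T` the slices of the patch EQUAL those of the classical `u`
      have hrepD : ∀ t' ∈ Ioo 0 (τ₂ - τ₁),
          fderiv ℝ ((fun t => w (t + ε)) t') = fderiv ℝ (u (t' + τ₁)) := by
        intro t' ht'
        have ht'T : t' + τ₁ < T := by linarith [ht'.2]
        have ht'0 : 0 ≤ t' + τ₁ := by linarith [ht'.1, hτ₁.1]
        have hcu : Continuous (u (t' + τ₁)) := (hcl.contDiff_velocity ⟨ht'0, ht'T⟩).continuous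
        have hcw : Continuous (w (t' + ε)) :=
          (hw'.contDiff_velocity ⟨ht'.1.le, ht'.2.le.trans hs12.2⟩).continuous
        have heq : u (t' + τ₁) = w (t' + ε) :=
          (Continuous.ae_eq_iff_eq volume hcu hcw).1 (hrep' t' ⟨ht'.1.le, ht'.2.le.trans hs12.2⟩)
        simp only [heq]
      -- the time-shifted majorant is a majorant for the representative
      have hmaj' : ∀ t' ∈ Ioo 0 (τ₂ - τ₁), ∀ x, ∃ v w' : EuclideanSpace ℝ (Fin 3),
          ‖v‖ = 1 ∧ ‖w'‖ = 1 ∧ ⟪v, w'⟫ = 0 ∧ ∀ α' β' : ℝ,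
            ⟪fderiv ℝ ((fun t => w (t + ε)) t') x (α' • v + β' • w'), α' • v + β' • w'⟫ ≤
              (fun t'' x' => m (t'' + τ₁) x') t' x * (α' ^ 2 + β' ^ 2) := by
        intro t' ht' x
        have ht'T : t' + τ₁ < T := by linarith [ht'.2]
        have ht'0 : 0 ≤ t' + τ₁ := by linarith [ht'.1, hτ₁.1]
        rw [hrepD t' ht']
        exact hmaj (t' + τ₁) ⟨ht'0, ht'T⟩ x
      -- the time weight of the representative
      have hint : ∫⁻ t' in Ioo 0 (τ₂ - τ₁), (∫⁻ x, ENNReal.ofReal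
          ((fun t'' x' => m (t'' + τ₁) x') t' x) ^ r) ^ (2 / (2 * r - 3)) =
          ∫⁻ σ' in Ioo τ₁ τ₂, a σ' := by
        have h := setLIntegral_Ioo_comp_add_right a 0 (τ₂ - τ₁) τ₁
        rw [zero_add, sub_add_cancel] at h
        simpa only [ha] using h
      have hsub12 : Ioo τ₁ τ₂ ⊆ Ioo 0 T := Ioo_subset_Ioo (by linarith [hτ₁.1]) hτ₂T.le
      have hfin12 : ∫⁻ σ' in Ioo τ₁ τ₂, a σ' ≠ ⊤ := ne_top_of_le_ne_top hA (lintegral_mono_set hsub12)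
      have hfinw : ∫⁻ t' in Ioo 0 (τ₂ - τ₁), (∫⁻ x, ENNReal.ofReal
          ((fun t'' x' => m (t'' + τ₁) x') t' x) ^ r) ^ (2 / (2 * r - 3)) ≠ ⊤ := by
        rw [hint]; exact hfin12
      -- Miller's enstrophy inequality on the translated slab
      have hineq := hD2 hν hL hw' hbw' hbwt' hbπ' (m := fun t'' x' => m (t'' + τ₁) x')
        (fun t'' x' => hm0 _ x') hs12 hmaj' hfinw
      rw [hint] at hineq
      -- identify the enstrophies with those of `u`
      have hy2 : eWeakGradL2Sq (u τ₂) =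
          ∫⁻ x, ENNReal.ofReal (frobeniusNormSq (fderiv ℝ (w (τ₂ - τ₁ + ε)) x)) := by
        have h := eWeakGradL2Sq_rep hw' ⟨hs12.1.le, hs12.2⟩ (hrep' (τ₂ - τ₁) ⟨hs12.1.le, hs12.2⟩)
        rwa [sub_add_cancel] at h
      have hy1 : eWeakGradL2Sq (u τ₁) =
          ∫⁻ x, ENNReal.ofReal (frobeniusNormSq (fderiv ℝ (w (0 + ε)) x)) := by
        have h := eWeakGradL2Sq_rep hw' ⟨le_rfl, hL.le⟩ (hrep' 0 ⟨le_rfl, hL.le⟩)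
        rwa [zero_add τ₁] at h
      have hstep : eWeakGradL2Sq (u τ₂) ≤
          ENNReal.ofReal (Real.exp (Cν * (∫⁻ σ' in Ioo τ₁ τ₂, a σ').toReal)) * eWeakGradL2Sq (u τ₁) := by
        rw [hy2, hy1]
        exact hineq
      have hfin02 : ∫⁻ σ' in Ioo t₀ τ₂, a σ' ≠ ⊤ :=
        ne_top_of_le_ne_top hA (lintegral_mono_set (Ioo_subset_Ioo ht₀0.le hτ₂T.le))
      exact exp_lintegral_chain (y := fun τ => eWeakGradL2Sq (u τ)) (a := a) (C := Cν) (y₀ := y₀)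
        hτ₁.1 hτ₁₂ hfin02 hP1 hstep
  -- conclusion
  refine hPt.trans (mul_le_mul_left (ENNReal.ofReal_le_ofReal (Real.exp_le_exp.2
    (mul_le_mul_of_nonneg_left ?_ hCν0))) _)
  exact ENNReal.toReal_mono hA (lintegral_mono_set (Ioo_subset_Ioo ht₀0.le htT.le))

/-- **The continuation hypothesis in Miller's class**: for a classical solution on `ℝ³ × [0, T)`,
Leray–Hopf on `[0, T)`, with a nonnegative two-frame majorant `m` of the middle principal strain on
`[0, T) × ℝ³` such that `∫₀ᵀ (∫ m(t)^r)^{2/(2r-3)} < ∞` (`3/2 < r`),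
`limsup_{t → β⁻} ‖u(t)‖²_{H¹} < ∞` at the right end `β` of every `H¹`-regular interval
`(α, β) ⊆ (0, T)` — the hypothesis of Leray's continuation theorem `leray_continuation_H1`
(energy from the datum, `IsLerayHopfOn.eEnergy_le_datum`; enstrophy from
`exists_eWeakGradL2Sq_le_of_midStrain`). [cite: Miller2019, Thm 1.1 (proof of Thm 5.2)]
[cite: RobinsonRodrigoSadowski2016, Lemma 8.16 (proof)] -/
theorem limsup_eH1NormSq_lt_top_of_midStrain {c : ℝ} (hL2 : TaoH1AlmostRegularWith c) (hc : 0 < c)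
    (hν : 0 < ν) (hLH : IsLerayHopfOn T ν 0 u₀ u) (hcl : IsClassicalNSSolutionOn (Ico 0 T) ν 0 u p)
    {r : ℝ} (hr : 3 / 2 < r)
    {m : ℝ → EuclideanSpace ℝ (Fin 3) → ℝ} (hm0 : ∀ t x, 0 ≤ m t x)
    (hmaj : ∀ t ∈ Ico 0 T, ∀ x, ∃ v w : EuclideanSpace ℝ (Fin 3), ‖v‖ = 1 ∧ ‖w‖ = 1 ∧
      ⟪v, w⟫ = 0 ∧ ∀ α β : ℝ,
        ⟪fderiv ℝ (u t) x (α • v + β • w), α • v + β • w⟫ ≤ m t x * (α ^ 2 + β ^ 2))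
    (hA : ∫⁻ t in Ioo 0 T, (∫⁻ x, ENNReal.ofReal (m t x) ^ r) ^ (2 / (2 * r - 3)) ≠ ⊤)
    {α β : ℝ} (hα : 0 ≤ α) (hαβ : α < β) (hβ : β ≤ T) (hreg : IsH1RegularOn (Ioo α β) u) :
    limsup (fun t => eH1NormSq (u t)) (𝓝[<] β) < ⊤ := by
  set t₀ : ℝ := (α + β) / 2 with ht₀
  have ht₀m : t₀ ∈ Ioo α β := ⟨by rw [ht₀]; linarith, by rw [ht₀]; linarith⟩
  obtain ⟨K, hK, hbound⟩ :=
    exists_eWeakGradL2Sq_le_of_midStrain hL2 hc hν hLH hcl hr hm0 hmaj hA hα hβ hreg ht₀m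
  set E₀ : ℝ≥0∞ := ENNReal.ofReal (2 * VectorCalculus.kineticEnergy u₀) with hE₀
  have hev : ∀ᶠ t in 𝓝[<] β, eH1NormSq (u t) ≤ E₀ + K := by
    filter_upwards [Ioo_mem_nhdsLT ht₀m.2] with t ht
    have htT : t ∈ Icc 0 T := ⟨(hα.trans ht₀m.1.le).trans ht.1.le, ht.2.le.trans hβ⟩
    exact add_le_add (hLH.eEnergy_le_datum hν.le htT) (hbound t ⟨ht.1.le, ht.2⟩)
  refine lt_of_le_of_lt (Filter.limsup_le_of_le (by isBoundedDefault) hev) ?_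
  exact ENNReal.add_lt_top.2 ⟨ENNReal.ofReal_lt_top, hK⟩

end StepA

/-! ### The discharge -/

section Discharge

/-- **Miller's middle-eigenvalue criterion (continuation form on `ℝ³`), discharged**: the named
fact `Miller2019.middleEigenvalueCriterion` (`MillerMiddleEigenvalueCriterion.lean`; Miller 2019,
Thm. 1.1 = Thm. 5.2: "if `2/p + 3/q = 2` with `3/2 < q ≤ +∞`, then
`‖u(·,T)‖²_{Ḣ¹} ≤ ‖u⁰‖²_{Ḣ¹} exp(C_q ∫₀ᵀ ‖λ₂⁺(·,t)‖^p_{L^q} dt)` … In particular if `T_max < +∞`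
then `∫₀^{T_max} ‖λ₂⁺‖^p_{L^q} = +∞`"; priority Neustupa–Penel 2001). Proof: the mixed-norm
hypothesis is a finite time weight `∫₀ᵀ (∫ m(t)^q)^{2/(2q-3)}`; hence the `H¹` norm cannot blow up
at the right end of an interval of regularity (`limsup_eH1NormSq_lt_top_of_midStrain`, Miller's
enstrophy inequality on Tao patches), so `u` is `H¹`-regular on `(0, T]` by Leray's continuation
theorem (`leray_continuation_H1_holds`); finally, exactly as in the tree's discharge of Beirão da
Veiga's criterion (`BeiraoDaVeiga1995_gradientCriterion_holds`; Robinson–Rodrigo–Sadowski 2016,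
proof of Thm. 12.3, p. 170), restart at a good time `s` near `T` with Leray's local strong solution
(`leray_local_strong_H1_holds`, lifespan beyond `T` by the `H¹` bound on `[T/2, T]`), represent it
classically (`ladyzhenskaya_prodi_serrin_holds`, class `L^∞_t L⁶_x`), identify it with `u` on
`(s, T)` by weak–strong uniqueness and continuity, and glue (`IsClassicalNSSolutionOn.glue`). The
rapid-decay hypothesis of the fact is not needed. [cite: Miller2019, Thm 1.1 (proof of Thm 5.2)]
[cite: NeustupaPenel2001, Thm 2]
[cite: RobinsonRodrigoSadowski2016, Thm. 8.17 with Lemma 8.16 and proof of Thm. 12.3] -/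
theorem Miller2019.middleEigenvalueCriterion_holds : Miller2019.middleEigenvalueCriterion := by
  intro ν T hν hT u p hcl hLH _ q hq m hm0 hmaj hfin
  obtain ⟨c, hc, hL2⟩ := tao2011_H1_local_almost_regular_holds
  -- `u` is `H¹`-regular on `(0, T]`
  have hregT : IsH1RegularOn (Ioc 0 T) u :=
    leray_continuation_H1_holds ν T hν hT (u 0) u hLH fun α β hα hαβ hβ hregI =>
      limsup_eH1NormSq_lt_top_of_midStrain hL2 hc hν hLH hcl hq hm0 hmaj hfin.ne hα hαβ hβ hregI
  -- `‖u(t)‖²_{H¹} ≤ A < ∞` on `[T/2, T]`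
  have hreg : IsH1RegularOn (Icc (T / 2) T) u :=
    hregT.mono fun t ht => ⟨by linarith [ht.1], ht.2⟩
  obtain ⟨A, hAtop, hAle⟩ := hreg.exists_forall_le isCompact_Icc subset_rfl
  -- Leray's lifespan for data of squared `H¹` norm `≤ a = A.toReal`
  obtain ⟨c', hc', hlocc⟩ := leray_local_strong_H1_holds
  have hLPS : ladyzhenskaya_prodi_serrin := ladyzhenskaya_prodi_serrin_holds
  set a : ℝ := A.toReal with ha
  have ha0 : 0 ≤ a := ENNReal.toReal_nonneg
  set τ : ℝ := c' * ν ^ 3 / (a ^ 2 + 1) with hτ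
  have hcν : 0 < c' * ν ^ 3 := mul_pos hc' (pow_pos hν 3)
  have hτpos : 0 < τ := div_pos hcν (by positivity)
  have hτc : a ^ 2 * τ ≤ c' * ν ^ 3 := by
    have h1 : a ^ 2 * τ = c' * ν ^ 3 * (a ^ 2 / (a ^ 2 + 1)) := by
      rw [hτ]
      ring
    rw [h1]
    exact mul_le_of_le_one_right hcν.le (div_le_one_of_le₀ (by linarith) (by positivity))
  -- a good restart time `s ∈ (max (T/2) (T - τ/2), T)`
  set s₀ : ℝ := max (T / 2) (T - τ / 2) with hs₀
  have hs₀0 : 0 ≤ s₀ := le_max_of_le_left (by linarith)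
  have hs₀T : s₀ < T := max_lt (by linarith) (by linarith)
  obtain ⟨s, hs, hLHs⟩ := hLH.exists_isLerayHopfOn_restart_Ioo hν.le hs₀0 hs₀T le_rfl
  have hsT2 : T / 2 ≤ s := (le_max_left _ _).trans hs.1.le
  have hsτ : T < s + τ := by
    have h1 : T - τ / 2 < s := (le_max_right _ _).trans_lt hs.1
    linarith
  have hs0 : 0 < s := by linarith
  have hTs : 0 < T - s := sub_pos.2 hs.2
  have hTsτ : T - s ≤ τ := by linarith
  -- the datum `u s ∈ H¹` with `‖∇u(s)‖² ≤ a`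
  have hu2 : MemLp (u s) 2 volume := hLH.memLp s ⟨hs0.le, hs.2.le⟩
  have hdiv : IsWeaklyDivFree (u s) := hLHs.isWeaklyDivFree_datum hTs
  have hgrad : eWeakGradL2Sq (u s) ≤ ENNReal.ofReal a := by
    calc eWeakGradL2Sq (u s) ≤ eH1NormSq (u s) := le_add_self
      _ ≤ A := hAle s ⟨hsT2, hs.2.le⟩
      _ = ENNReal.ofReal a := (ENNReal.ofReal_toReal hAtop.ne).symm
  -- Leray's local strong solution `v` from `u s` on `[0, τ]` (RRS Thm. 6.15)
  obtain ⟨v, hv, hv0, hvreg⟩ := hlocc hν hτpos hu2 hdiv ha0 hgrad hτc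
  -- its classical representative `(V, P)` on `(0, τ]` (RRS Thm. 8.17, first clause, `L^∞_t L⁶_x`)
  have hvS : MemLqLp ∞ 6 v (Ioo 0 τ) :=
    memLqLp_top_six_of_isH1RegularOn_Icc hvreg fun t ht => hv.memLp t ht
  have hr6 : (3 : ℝ≥0∞) < 6 := by norm_num
  have hqr6 : 2 / (∞ : ℝ≥0∞) + 3 / (6 : ℝ≥0∞) ≤ 1 := by
    rw [ENNReal.div_top, zero_add]
    exact ENNReal.div_le_of_le_mul (by norm_num)
  obtain ⟨V, P, hVP, hvV⟩ := hLPS hν hτpos hv hr6 hqr6 hvS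
  -- weak–strong uniqueness on `[0, T - s)`: `u (t + s) = v t` a.e., `0 < t ≤ T - s`
  have hae : ∀ t ∈ Ioc 0 (T - s), (fun t => u (t + s)) t =ᵐ[volume] v t :=
    serrin_weak_strong_uniqueness_holds hν hTs (hv.of_le hTsτ) hu2 (q := ∞) (r := 6) hr6
      hqr6 (hvS.mono_set (Ioo_subset_Ioo_right hTsτ)) hLHs
  -- everywhere agreement of the continuous slices on `(s, T)`
  have heq : ∀ t ∈ Ioo s T, u t = V (t + -s) := by
    intro t ht
    have hts : t - s ∈ Ioc 0 (T - s) := ⟨sub_pos.2 ht.1, by linarith [ht.2]⟩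
    have h1 : u t =ᵐ[volume] v (t - s) := by
      have h := hae (t - s) hts
      simpa only [sub_add_cancel] using h
    have h2 : v (t - s) =ᵐ[volume] V (t - s) := hvV (t - s) ⟨hts.1, hts.2.trans hTsτ⟩
    have hcu : Continuous (u t) :=
      (hcl.contDiff_velocity ⟨hs0.le.trans ht.1.le, ht.2⟩).continuous
    have hcV : Continuous (V (t - s)) :=
      (hVP.contDiff_velocity ⟨hts.1, hts.2.trans hTsτ⟩).continuous
    rw [← sub_eq_add_neg]
    exact (Continuous.ae_eq_iff_eq volume hcu hcV).1 (h1.trans h2)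
  -- the continuation piece `(V, P)(· - s)` on `(s, s + τ)`
  have h₂ : IsClassicalNSSolutionOn (Ioo s (s + τ)) ν 0 (fun t => V (t + -s))
      (fun t => P (t + -s)) := by
    have hVP' := hVP.comp_add_right (-s)
    have h0 : (fun t => (0 : ℝ → EuclideanSpace ℝ (Fin 3) → EuclideanSpace ℝ (Fin 3)) (t + -s)) = 0 :=
      rfl
    rw [h0] at hVP'
    exact hVP'.mono (fun t ht => ⟨by simp only [mem_Ioo] at ht ⊢; linarith [ht.1],
      by simp only [mem_Ioo] at ht ⊢; linarith [ht.2]⟩) isOpen_Ioo.uniqueDiffOn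
  -- glue along the overlap `(s, T)`
  exact ⟨s + τ, hsτ, _, _, hcl.glue h₂ hs0.le hs.2 hsτ.le heq, fun t ht => by
    simp only [if_pos ht.2]⟩

end Discharge

end Literature.Analysis.FluidPDE

end
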